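import Literature.NumberTheory.GaussSums.PadicStationaryPhase

/-!
# Proof of the `p`-adic stationary phase formula, even exponent (Dąbrowski–Fisher, Thm. 1.8 (a))

Sibling proofs file of `Literature/NumberTheory/GaussSums/PadicStationaryPhase.lean`: it discharges
the named fact `Literature.NumberTheory.GaussSums.dabrowskiFisher1997_thm18a_even` as
`dabrowskiFisher1997_thm18a_even_holds : dabrowskiFisher1997_thm18a_even` (no hypotheses added,
statement untouched).

* R. Dąbrowski, B. Fisher, *A stationary phase formula for exponential sums over `ℤ/p^mℤ` and
  applications to GL(3)-Kloosterman sums*, Acta Arith. 80 (1997) 1–48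
  (doi:10.4064/aa-80-1-1-48; IMPAN open copy read 2026-08-15): Theorem 1.8 (a), PDF p. 10;
  Remark 1.9 (2), p. 11; "Proof of Theorem 1.8 (a)", p. 20. [`DabrowskiFisher1997`]

## The argument (as printed, p. 20, for `V = 𝔸ⁿ`, `m = 2j`; we write `M = p^j`, `N = p^{2j} = M·M`)

1. *Fibre parameterization* (p. 20: "The fiber `ϱ⁻¹(x̄)` is parameterized by `x + p^j y` with
   `y ∈ 𝔸ⁿ(ℤ/p^{m-j}ℤ)`"): `s ↦ x + M·s̃` (`s̃ ∈ {0, …, M-1}` the least residue of `s ∈ ℤ/M`) is a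
   bijection `(ℤ/M)ⁿ → {y ∈ (ℤ/N)ⁿ : ȳ = x̄}` (`DabrowskiFisher1997.sum_fibre_eq_sum_lift`).
2. *First-order Taylor expansion* (p. 20: "`f(x + p^j y) = f(x) + p^j grad f(x)·y ∈ ℤ/p^mℤ`"):
   the increments `M·s̃_i` have pairwise vanishing products in `ℤ/N`, and over any commutative
   ring `g(x + y) = g(x) + ∑_i ∂_i g(x) y_i` as soon as all `y_i y_k = 0`
   (`DabrowskiFisher1997.eval_add_of_mul_eq_zero`, induction on `g`; Mathlib only has the
   one-variable `Polynomial.eval_add_of_sq_eq_zero`).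
3. *Orthogonality* (Remark 1.9 (2), p. 11: "the sum of a non-trivial character over a finite
   group vanishes"; p. 20: "The inner sum vanishes unless `grad f(x) ≡ 0 (mod p^j)`"):
   `t ↦ e(c · M t̃ / N)` is an additive character of `ℤ/M`, trivial iff `c ≡ 0 (mod M)`, so
   `∑_{s ∈ (ℤ/M)ⁿ} ∏_i e(∂_i f(x) · M s̃_i / N) = ∏_i ∑_{t ∈ ℤ/M} e(∂_i f(x) M t̃/N)` is
   `Mⁿ = p^{nj}` if `grad f(x̄) ≡ 0 (mod M)` and `0` otherwise
   (`DabrowskiFisher1997.sum_stdAddChar_mul_lift`, via `AddChar.sum_eq_zero_of_ne_one` /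
   `AddChar.sum_eq_card_of_eq_one`).

Deviations from the printed text: none in substance; the lift `y ↦ p^j y` is realised on least
residues (`s ↦ ((p^j * s.val : ℕ) : ZMod (p^{2j}))`) rather than on the abstract group
`p^jℤ/p^{2j}ℤ`, and the criticality condition `grad f(x̄) = 0 ∈ (ℤ/p^j)ⁿ` of the statement is read
through the reduction map by `MvPolynomial.eval₂_comp_left` (`hcond` in the final proof).
-/

namespace Literature.NumberTheory.GaussSums

open MvPolynomial

namespace DabrowskiFisher1997

variable {M N : ℕ}

/-- `M·(v mod M) = M·v` in `ℤ/N` for `N = M²`. [folklore] -/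
theorem natCast_mul_mod (hMN : N = M * M) (v : ℕ) :
    ((M * (v % M) : ℕ) : ZMod N) = ((M * v : ℕ) : ZMod N) := by
  conv_rhs => rw [← Nat.mod_add_div v M]
  rw [mul_add, ← mul_assoc, ← hMN, Nat.cast_add, Nat.cast_mul N, ZMod.natCast_self, zero_mul,
    add_zero]

/-- The products of two increments `p^j a · p^j b` vanish in `ℤ/p^{2j}ℤ` (this kills the higher
Taylor terms when `m = 2j`, PDF p. 20). [cite: DabrowskiFisher1997, Thm. 1.8 (a), proof p. 20] -/
theorem natCast_mul_mul_natCast_mul (hMN : N = M * M) (a b : ℕ) :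
    ((M * a : ℕ) : ZMod N) * ((M * b : ℕ) : ZMod N) = 0 := by
  rw [← Nat.cast_mul, show M * a * (M * b) = N * (a * b) by rw [hMN]; ring, Nat.cast_mul,
    ZMod.natCast_self, zero_mul]

/-- `s ↦ M·s̃` is additive `ℤ/M → ℤ/N`. [folklore] -/
theorem natCast_mul_val_add [NeZero M] (hMN : N = M * M) (a b : ZMod M) :
    ((M * (a + b).val : ℕ) : ZMod N) = ((M * a.val : ℕ) : ZMod N) + ((M * b.val : ℕ) : ZMod N) := by
  rw [ZMod.val_add, natCast_mul_mod hMN, mul_add, Nat.cast_add]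

/-- The reduction `ℤ/N → ℤ/M` on least residues. [folklore] -/
theorem castHom_eq_natCast_val [NeZero N] (hd : M ∣ N) (z : ZMod N) :
    ZMod.castHom hd (ZMod M) z = ((z.val : ℕ) : ZMod M) := by
  rw [ZMod.castHom_apply, ZMod.cast_eq_val]

/-- The lifts `M·k` reduce to `0` modulo `M`. [folklore] -/
theorem castHom_natCast_mul (hd : M ∣ N) (k : ℕ) :
    ZMod.castHom hd (ZMod M) ((M * k : ℕ) : ZMod N) = 0 := by
  rw [map_natCast, ZMod.natCast_eq_zero_iff]
  exact dvd_mul_right M k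

/-- Every element of the kernel of `ℤ/p^{2j} → ℤ/p^j` is a lift `p^j s̃` (surjectivity of the
fibre parameterization, PDF p. 20). [cite: DabrowskiFisher1997, Thm. 1.8 (a), proof p. 20] -/
theorem natCast_mul_val_div [NeZero N] (hMN : N = M * M) (hd : M ∣ N) {z : ZMod N}
    (hz : ZMod.castHom hd (ZMod M) z = 0) :
    ((M * ((z.val / M : ℕ) : ZMod M).val : ℕ) : ZMod N) = z := by
  rw [castHom_eq_natCast_val hd, ZMod.natCast_eq_zero_iff] at hz
  rw [ZMod.val_natCast, natCast_mul_mod hMN, Nat.mul_div_cancel' hz, ZMod.natCast_zmod_val]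

/-- Injectivity of the fibre parameterization `s ↦ p^j s̃` (PDF p. 20). [folklore] -/
theorem val_natCast_mul_div [NeZero M] [NeZero N] (hMN : N = M * M) (s : ZMod M) :
    ((((M * s.val : ℕ) : ZMod N).val / M : ℕ) : ZMod M) = s := by
  have hlt : M * s.val < N := by
    rw [hMN]
    exact mul_lt_mul_of_pos_left (ZMod.val_lt s) (Nat.pos_of_ne_zero (NeZero.ne M))
  rw [ZMod.val_natCast, Nat.mod_eq_of_lt hlt,
    Nat.mul_div_cancel_left _ (Nat.pos_of_ne_zero (NeZero.ne M)), ZMod.natCast_zmod_val]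

/-- `c · p^j k = 0` in `ℤ/p^{2j}` whenever `c ≡ 0 (mod p^j)`. [folklore] -/
theorem mul_natCast_mul_eq_zero [NeZero N] (hMN : N = M * M) (hd : M ∣ N) {c : ZMod N}
    (hc : ZMod.castHom hd (ZMod M) c = 0) (k : ℕ) : c * ((M * k : ℕ) : ZMod N) = 0 := by
  rw [← natCast_mul_val_div hMN hd hc]
  exact natCast_mul_mul_natCast_mul hMN _ _

/-- Conversely, `c · p^j = 0` in `ℤ/p^{2j}` forces `c ≡ 0 (mod p^j)`. [folklore] -/
theorem castHom_eq_zero_of_mul_natCast [NeZero M] [NeZero N] (hMN : N = M * M) (hd : M ∣ N)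
    {c : ZMod N} (hc : c * (M : ZMod N) = 0) : ZMod.castHom hd (ZMod M) c = 0 := by
  rw [← ZMod.natCast_zmod_val c, ← Nat.cast_mul, ZMod.natCast_eq_zero_iff] at hc
  have hc' : M * M ∣ c.val * M := by
    rw [← hMN]
    exact hc
  rw [castHom_eq_natCast_val hd, ZMod.natCast_eq_zero_iff]
  exact Nat.dvd_of_mul_dvd_mul_right (Nat.pos_of_ne_zero (NeZero.ne M)) hc'

/-- **Step 1 (fibre parameterization, PDF p. 20).** The fibre of `(ℤ/p^{2j})ⁿ → (ℤ/p^j)ⁿ` over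
`x̄` is `{x + p^j s̃ : s ∈ (ℤ/p^j)ⁿ}`, each point hit exactly once.
[cite: DabrowskiFisher1997, Thm. 1.8 (a), proof p. 20] -/
theorem sum_fibre_eq_sum_lift [NeZero M] [NeZero N] (hMN : N = M * M) (hd : M ∣ N) {n : ℕ}
    (x : Fin n → ZMod N) (F : (Fin n → ZMod N) → ℂ) :
    (∑ y ∈ (Finset.univ : Finset (Fin n → ZMod N)).filter
        (fun y => (fun i => ZMod.castHom hd (ZMod M) (y i)) =
          fun i => ZMod.castHom hd (ZMod M) (x i)),
      F y) =
    ∑ s : Fin n → ZMod M, F (x + fun i => ((M * (s i).val : ℕ) : ZMod N)) := by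
  symm
  refine Finset.sum_nbij' (fun s => x + fun i => ((M * (s i).val : ℕ) : ZMod N))
    (fun y => fun i => (((y i - x i).val / M : ℕ) : ZMod M)) ?_ ?_ ?_ ?_ ?_
  · intro s _
    simp only [Finset.mem_filter, Finset.mem_univ, true_and]
    funext i
    rw [Pi.add_apply, map_add, castHom_natCast_mul, add_zero]
  · intro y _
    exact Finset.mem_univ _
  · intro s _
    funext i
    rw [Pi.add_apply, add_sub_cancel_left]
    exact val_natCast_mul_div hMN (s i)
  · intro y hy
    simp only [Finset.mem_filter, Finset.mem_univ, true_and] at hy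
    funext i
    have hi : ZMod.castHom hd (ZMod M) (y i - x i) = 0 := by
      rw [map_sub, sub_eq_zero]
      exact congrFun hy i
    rw [Pi.add_apply, natCast_mul_val_div hMN hd hi, add_sub_cancel]
  · intro s _
    rfl

/-- **Step 2 (first-order Taylor expansion, PDF p. 20: `f(x + p^j y) = f(x) + p^j grad f(x)·y` in
`ℤ/p^{2j}`).** Over any commutative ring, if all products `y_i y_k` vanish then
`g(x + y) = g(x) + ∑_i ∂_i g(x) y_i`. [folklore] -/
theorem eval_add_of_mul_eq_zero {R σ : Type*} [CommRing R] [Fintype σ]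
    (g : MvPolynomial σ R) (x y : σ → R) (hy : ∀ i k, y i * y k = 0) :
    MvPolynomial.eval (x + y) g =
      MvPolynomial.eval x g + ∑ i, MvPolynomial.eval x (MvPolynomial.pderiv i g) * y i := by
  induction g using MvPolynomial.induction_on with
  | C a => simp
  | add p q hp hq =>
    simp only [map_add, hp, hq, add_mul, Finset.sum_add_distrib]
    ring
  | mul_X p i ih =>
    have hS : (∑ k, eval x (pderiv k p) * y k) * y i = 0 := by
      rw [Finset.sum_mul]
      exact Finset.sum_eq_zero fun k _ => by rw [mul_assoc, hy k i, mul_zero]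
    have hT : (∑ k, eval x (pderiv k p) * y k) * x i = ∑ k, eval x (pderiv k p) * x i * y k := by
      rw [Finset.sum_mul]
      exact Finset.sum_congr rfl fun k _ => by ring
    have hsingle : ∑ k, eval x p * eval x (pderiv k (X i)) * y k = eval x p * y i := by
      rw [Finset.sum_eq_single i]
      · rw [pderiv_X_self, map_one, mul_one]
      · intro k _ hk
        rw [pderiv_X_of_ne (Ne.symm hk), map_zero, mul_zero, zero_mul]
      · intro h
        exact absurd (Finset.mem_univ i) h
    rw [map_mul, eval_X, Pi.add_apply, ih]
    simp only [pderiv_mul, map_add, map_mul, eval_X, add_mul, Finset.sum_add_distrib]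
    rw [hsingle, mul_add, mul_add, hS, hT]
    ring

/-- An additive character turns sums into products. [folklore] -/
theorem addChar_map_sum_eq_prod {A R ι : Type*} [AddCommMonoid A] [CommMonoid R]
    (ψ : AddChar A R) (s : Finset ι) (g : ι → A) : ψ (∑ i ∈ s, g i) = ∏ i ∈ s, ψ (g i) := by
  classical
  induction s using Finset.induction_on with
  | empty => simp
  | insert a s ha ih => rw [Finset.sum_insert ha, Finset.prod_insert ha, AddChar.map_add_eq_mul, ih]

/-- `e(a/N) = 1 ↔ a = 0` in `ℤ/N` (`ZMod.stdAddChar` is injective). [folklore] -/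
theorem stdAddChar_eq_one_iff [NeZero N] {a : ZMod N} : ZMod.stdAddChar a = 1 ↔ a = 0 := by
  rw [← (ZMod.stdAddChar (N := N)).map_zero_eq_one, ZMod.injective_stdAddChar.eq_iff]

/-- **Step 3 (orthogonality; Remark 1.9 (2), p. 11: "the sum of a non-trivial character over a
finite group vanishes").** For `c ∈ ℤ/p^{2j}`, `t ↦ e(c · p^j t̃ / p^{2j})` is an additive character
of `ℤ/p^j` (one coordinate of `y ↦ e^{2πi grad f(x)·y/p^j}`, PDF p. 20), trivial iff
`c ≡ 0 (mod p^j)`; hence `∑_{t ∈ ℤ/p^j} e(c p^j t̃/p^{2j})` is `p^j` if `c ≡ 0 (mod p^j)` and `0`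
otherwise. [cite: DabrowskiFisher1997, Thm. 1.8 (a), proof p. 20; Remark 1.9 (2)] -/
theorem sum_stdAddChar_mul_lift [NeZero M] [NeZero N] (hMN : N = M * M) (hd : M ∣ N)
    (c : ZMod N) :
    ∑ t : ZMod M, ZMod.stdAddChar (c * ((M * t.val : ℕ) : ZMod N)) =
      if ZMod.castHom hd (ZMod M) c = 0 then (M : ℂ) else 0 := by
  -- the additive character `t ↦ e(c · M t̃ / N)` of `ℤ/M`
  let ψ : AddChar (ZMod M) ℂ :=
    { toFun := fun t => ZMod.stdAddChar (c * ((M * t.val : ℕ) : ZMod N))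
      map_zero_eq_one' := by
        simp only [ZMod.val_zero, mul_zero, Nat.cast_zero, AddChar.map_zero_eq_one]
      map_add_eq_mul' := fun a b => by
        show ZMod.stdAddChar (c * ((M * (a + b).val : ℕ) : ZMod N)) =
          ZMod.stdAddChar (c * ((M * a.val : ℕ) : ZMod N)) *
            ZMod.stdAddChar (c * ((M * b.val : ℕ) : ZMod N))
        rw [natCast_mul_val_add hMN, mul_add, AddChar.map_add_eq_mul] }
  change ∑ t, ψ t = _
  split_ifs with hc
  · have hψ : ψ = 1 := by
      ext t
      change ZMod.stdAddChar (c * ((M * t.val : ℕ) : ZMod N)) = 1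
      rw [mul_natCast_mul_eq_zero hMN hd hc, AddChar.map_zero_eq_one]
    rw [AddChar.sum_eq_card_of_eq_one hψ, ZMod.card]
  · refine AddChar.sum_eq_zero_of_ne_one fun hψ => hc ?_
    have h1 : ZMod.stdAddChar (c * ((M * (1 : ZMod M).val : ℕ) : ZMod N)) = 1 := by
      change ψ 1 = 1
      rw [hψ, AddChar.one_apply]
    rw [ZMod.val_one_eq_one_mod, natCast_mul_mod hMN, mul_one, stdAddChar_eq_one_iff] at h1
    exact castHom_eq_zero_of_mul_natCast hMN hd h1

/-- Step 3 in all coordinates: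
`∑_{s ∈ (ℤ/p^j)ⁿ} ∏_i e(c_i p^j s̃_i/p^{2j}) = ∏_i ∑_t e(c_i p^j t̃/p^{2j})`, each factor `p^j`
or `0` according as `c_i ≡ 0 (mod p^j)` or not (PDF p. 20: "The inner sum vanishes unless
`grad f(x) ≡ 0 (mod p^j)`"). [cite: DabrowskiFisher1997, Thm. 1.8 (a), proof p. 20] -/
theorem sum_prod_stdAddChar_mul_lift [NeZero M] [NeZero N] (hMN : N = M * M) (hd : M ∣ N)
    {n : ℕ} (c : Fin n → ZMod N) :
    ∑ s : Fin n → ZMod M, ∏ i, ZMod.stdAddChar (c i * ((M * (s i).val : ℕ) : ZMod N)) =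
      ∏ i, (if ZMod.castHom hd (ZMod M) (c i) = 0 then (M : ℂ) else 0) := by
  refine (Fintype.prod_sum fun i (t : ZMod M) =>
    ZMod.stdAddChar (c i * ((M * t.val : ℕ) : ZMod N))).symm.trans ?_
  exact Finset.prod_congr rfl fun i _ => sum_stdAddChar_mul_lift hMN hd (c i)

end DabrowskiFisher1997

/-- **Dąbrowski–Fisher 1997, Theorem 1.8 (a), case `m = 2j`, `V = 𝔸ⁿ`** — discharge of the named
fact `dabrowskiFisher1997_thm18a_even`, following the printed proof (PDF p. 20): parameterize the
fibre by `x + p^j s̃`, expand `f(x + p^j s̃) = f(x) + p^j grad f(x)·s̃` in `ℤ/p^{2j}`, and sum the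
character `s ↦ e(grad f(x)·s/p^j)` over `(ℤ/p^j)ⁿ` (Remark 1.9 (2)).
[cite: DabrowskiFisher1997, Thm. 1.8 (a); proof p. 20; Remark 1.9 (2), p. 11] -/
theorem dabrowskiFisher1997_thm18a_even_holds : dabrowskiFisher1997_thm18a_even := by
  intro p hp n j f hj x
  have hMN : p ^ (2 * j) = p ^ j * p ^ j := by rw [two_mul, pow_add]
  have hd : p ^ j ∣ p ^ (2 * j) := pow_dvd_pow p (by omega)
  set g : MvPolynomial (Fin n) (ZMod (p ^ (2 * j))) :=
    MvPolynomial.map (Int.castRingHom (ZMod (p ^ (2 * j)))) f with hg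
  -- Step 1: fibre parameterization `y = x + p^j s̃`, `s ∈ (ℤ/p^j)ⁿ`.
  refine (DabrowskiFisher1997.sum_fibre_eq_sum_lift hMN hd x fun y =>
    ZMod.stdAddChar (N := p ^ (2 * j)) (MvPolynomial.eval y g)).trans ?_
  -- Step 2: Taylor expansion; the phase factors as `e(f(x)) · ∏_i e(∂_i f(x) p^j s̃_i / p^{2j})`.
  have htaylor : ∀ s : Fin n → ZMod (p ^ j),
      MvPolynomial.eval (x + fun i => ((p ^ j * (s i).val : ℕ) : ZMod (p ^ (2 * j)))) g =
        MvPolynomial.eval x g + ∑ i, MvPolynomial.eval x (MvPolynomial.pderiv i g) *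
          ((p ^ j * (s i).val : ℕ) : ZMod (p ^ (2 * j))) := fun s =>
    DabrowskiFisher1997.eval_add_of_mul_eq_zero g x _ fun i k =>
      DabrowskiFisher1997.natCast_mul_mul_natCast_mul hMN _ _
  simp_rw [htaylor, AddChar.map_add_eq_mul, ← Finset.mul_sum,
    DabrowskiFisher1997.addChar_map_sum_eq_prod]
  -- Step 3: orthogonality, coordinate by coordinate.
  rw [DabrowskiFisher1997.sum_prod_stdAddChar_mul_lift hMN hd]
  -- The criticality condition, read through the reduction map.
  have hcond : ∀ i, ZMod.castHom hd (ZMod (p ^ j)) (MvPolynomial.eval x (MvPolynomial.pderiv i g)) =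
      MvPolynomial.eval (reducePow p n j x)
        (MvPolynomial.map (Int.castRingHom (ZMod (p ^ j))) (MvPolynomial.pderiv i f)) := by
    intro i
    rw [hg, pderiv_map, eval_map, eval₂_comp_left, eval_map]
    congr 1
    exact RingHom.ext_int _ _
  by_cases hcrit : ∀ i : Fin n, MvPolynomial.eval (reducePow p n j x)
      (MvPolynomial.map (Int.castRingHom (ZMod (p ^ j))) (MvPolynomial.pderiv i f)) = 0
  · rw [if_pos hcrit]
    have hfac : ∀ i, (if ZMod.castHom hd (ZMod (p ^ j))
        (MvPolynomial.eval x (MvPolynomial.pderiv i g)) = 0 then ((p ^ j : ℕ) : ℂ) else 0) =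
        ((p ^ j : ℕ) : ℂ) := fun i => if_pos ((hcond i).trans (hcrit i))
    simp_rw [hfac]
    rw [Finset.prod_const, Finset.card_univ, Fintype.card_fin]
    push_cast
    ring
  · rw [if_neg hcrit]
    push Not at hcrit
    obtain ⟨i, hi⟩ := hcrit
    rw [Finset.prod_eq_zero (Finset.mem_univ i), mul_zero]
    rw [if_neg]
    rwa [hcond i]

end Literature.NumberTheory.GaussSums
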